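import Literature.AnabelianGeometry.SemiGraphs.ArithmeticDef51CondCClosures
import Literature.AnabelianGeometry.SemiGraphs.AmbientVocabOfRealOut
import Literature.AnabelianGeometry.SemiGraphs.Localizations
import HarnessLib

/-!
# The functoriality laws of the BRANCH maps of the §§4–5 container `SemiAnbdVocab` ([SemiAnbd] §1 p.11)

Mochizuki, *Semi-graphs of anabelioids*, Publ. RIMS **42** (2006), §1 p.11: a morphism of semi-graphs is
a map on vertices and edges "together with, for each edge `e ↦ e'`, a bijection `e ⥲ e'`" of branches;
identities and composites are the evident ones (kurims `paper:url-f33ace170ff4`).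
[cite: MochizukiSemiAnbd2006, §1, p. 11]

GAP-LEDGER row **G-f184-1** (abc-iut-f-184, 2026-08-26T08:52:48Z; kernel evidence p432515
`not_forall_def51CondC_one`): the hypothesis container `SemiAnbdVocab` (`InterfaceVocab.lean`,
abc-iut-L3-t3) carries the functoriality laws `mapV_id/comp`, `mapE_id/comp` of the underlying
morphism of semi-graphs but NO law for the branch maps `mapBr`, so over a lawless junk container the
identity arrow may swap the two branches of an edge, and consumers such as
`Def51CondC.fixesBr` ([SemiAnbd] Def 5.1 (i)(c), `Arithmetic.lean`) or `Loc.IsPiecewiseFaithful`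
(Def 4.1 (i), `Localizations.lean`) had to carry the law as a binder (`hid` of `def51CondC_of_le_ker`).

DISPOSITION BY THE INTERFACE OWNER (abc-iut-L3-t3 gen 5), ADDITIVE — the container is FROZEN and
constructed field-by-field in several landed files (`SemiAnbdVocab.ofReal`, the junk witnesses of
`ArithmeticDef51Cond*Closures.lean`), so new structure FIELDS would break every importer; instead the
two wanted laws are packaged, in exactly the Σ-form of the row, as ONE explicit law-structure
`SemiAnbdVocab.BrLaws 𝓥 : Prop` beside the container (no instance, no new Prop-valued *fact*: a formal
law "that holds for the real objects by construction", in the words of `InterfaceVocab.lean`), with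

* the formal consequences §§4–5 use silently — the identity fixes all branches, isomorphisms act
  bijectively on branches with the inverse arrow as inverse, the branch maps at a vertex
  (`mapBrAt`) are functorial, identities are immersions / excisions / embeddings of semi-graphs and
  these three classes are closed under composition (§1 pp.12–14), the fixing clause of Def 4.1 (i) is
  satisfied by `γ = 1`;
* the consumer corollaries `def51CondC_of_brLaws_of_le_ker` / `def51CondC_one_of_brLaws`
  (f-184's `def51CondC_of_le_ker` / `def51CondC_one` with the binder `hid` DISCHARGED from `BrLaws`);
* the discharge at the real vocabulary: `SemiAnbdVocab.ofReal_brLaws` (both laws hold at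
  `SemiAnbdVocab.ofReal R` by `rfl`, for every residual `R`) and `SemiAnbdVocab.ofRealOfTempered_brLaws`.

Nothing here asserts a result of the paper; no side taken on [IUTchIII] Cor. 3.12; typed ≠ proved.
-/

namespace Literature.AnabelianGeometry.SemiGraphs

open _root_.CategoryTheory

universe u v w

namespace SemiAnbdVocab

variable {Obj : Type u} [Category.{v} Obj] (𝓥 : SemiAnbdVocab.{u, v, w} Obj)

/-! ### The law-structure -/

/-- **Functoriality of the branch maps** of the underlying morphisms of semi-graphs of a container
`𝓥 : SemiAnbdVocab Obj` ([SemiAnbd] §1 p.11: a morphism carries, "for each edge `e ↦ e'`, a bijection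
`e ⥲ e'`"; the bijection of an identity is the identity and that of a composite is the composite) —
stated on the total space of branches `Σ e, Br e` (the Σ-form avoids the dependent cast through
`mapE_id` / `mapE_comp`).  GAP-LEDGER G-f184-1, additive disposition: an explicit hypothesis
structure beside the (frozen) container, discharged at the real vocabulary by `ofReal_brLaws`.
[cite: MochizukiSemiAnbd2006, §1, p. 11] -/
structure BrLaws : Prop where
  /-- the identity arrow induces the identity on branches -/
  mapBr_id : ∀ (G : Obj) (x : Σ e : 𝓥.Edge G, 𝓥.Br e), 𝓥.mapTotalBr (𝟙 G) x = x
  /-- a composite arrow induces the composite map on branches -/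
  mapBr_comp : ∀ {G H K : Obj} (f : G ⟶ H) (g : H ⟶ K) (x : Σ e : 𝓥.Edge G, 𝓥.Br e),
    𝓥.mapTotalBr (f ≫ g) x = 𝓥.mapTotalBr g (𝓥.mapTotalBr f x)

variable {𝓥}

/-! ### Formal consequences valid for every container satisfying the laws -/

section AnyContainer

/-- Two points of the total space of branches with equal underlying data have equal images under
the coincidence map. [cite: MochizukiSemiAnbd2006, §1, p. 11] -/
theorem abut_eq_of_sigma_eq {G : Obj} {x y : Σ e : 𝓥.Edge G, 𝓥.Br e} (h : x = y) :
    𝓥.abut x.2 = 𝓥.abut y.2 := by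
  subst h; rfl

namespace BrLaws

variable (h𝓥 : 𝓥.BrLaws)
include h𝓥

/-- The identity arrow fixes every branch. [cite: MochizukiSemiAnbd2006, §1, p. 11] -/
theorem mapTotalBr_id (G : Obj) (x : Σ e : 𝓥.Edge G, 𝓥.Br e) : 𝓥.mapTotalBr (𝟙 G) x = x :=
  h𝓥.mapBr_id G x

/-- Composites act on branches by the composite map. [cite: MochizukiSemiAnbd2006, §1, p. 11] -/
theorem mapTotalBr_comp {G H K : Obj} (f : G ⟶ H) (g : H ⟶ K) (x : Σ e : 𝓥.Edge G, 𝓥.Br e) :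
    𝓥.mapTotalBr (f ≫ g) x = 𝓥.mapTotalBr g (𝓥.mapTotalBr f x) :=
  h𝓥.mapBr_comp f g x

/-- The branch map of the total space is functorial as a function: composites.
[cite: MochizukiSemiAnbd2006, §1, p. 11] -/
theorem mapTotalBr_comp_eq {G H K : Obj} (f : G ⟶ H) (g : H ⟶ K) :
    𝓥.mapTotalBr (f ≫ g) = 𝓥.mapTotalBr g ∘ 𝓥.mapTotalBr f :=
  funext fun x => h𝓥.mapBr_comp f g x

/-- The branch map of the identity is the identity function. [cite: MochizukiSemiAnbd2006, §1, p. 11] -/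
theorem mapTotalBr_id_eq (G : Obj) : 𝓥.mapTotalBr (𝟙 G) = id :=
  funext fun x => h𝓥.mapBr_id G x

/-- An isomorphism followed by its inverse fixes every branch. [cite: MochizukiSemiAnbd2006, §1, p. 11] -/
theorem mapTotalBr_inv_hom_apply {G H : Obj} (i : G ≅ H) (x : Σ e : 𝓥.Edge G, 𝓥.Br e) :
    𝓥.mapTotalBr i.inv (𝓥.mapTotalBr i.hom x) = x := by
  rw [← h𝓥.mapBr_comp, i.hom_inv_id, h𝓥.mapBr_id]

/-- The inverse of an isomorphism followed by the isomorphism fixes every branch.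
[cite: MochizukiSemiAnbd2006, §1, p. 11] -/
theorem mapTotalBr_hom_inv_apply {G H : Obj} (i : G ≅ H) (y : Σ e : 𝓥.Edge H, 𝓥.Br e) :
    𝓥.mapTotalBr i.hom (𝓥.mapTotalBr i.inv y) = y := by
  rw [← h𝓥.mapBr_comp, i.inv_hom_id, h𝓥.mapBr_id]

/-- An isomorphism acts bijectively on the total space of branches ("a bijection `e ⥲ e'`" for each
edge, and a bijection on edges). [cite: MochizukiSemiAnbd2006, §1, p. 11] -/
theorem mapTotalBr_bijective_of_iso {G H : Obj} (i : G ≅ H) :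
    Function.Bijective (𝓥.mapTotalBr i.hom) :=
  Function.bijective_iff_has_inverse.mpr
    ⟨𝓥.mapTotalBr i.inv, h𝓥.mapTotalBr_inv_hom_apply i, h𝓥.mapTotalBr_hom_inv_apply i⟩

/-- An automorphism and its group inverse: `γ⁻¹` undoes `γ` on branches.
[cite: MochizukiSemiAnbd2006, §1, p. 11] -/
theorem mapTotalBr_aut_inv_apply {G : Obj} (γ : Aut G) (x : Σ e : 𝓥.Edge G, 𝓥.Br e) :
    𝓥.mapTotalBr (γ⁻¹).hom (𝓥.mapTotalBr γ.hom x) = x :=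
  h𝓥.mapTotalBr_inv_hom_apply γ x

/-- The group law of `Aut G` on branches: a product acts as the composite (`(γ * δ).hom = δ.hom ≫ γ.hom`).
[cite: MochizukiSemiAnbd2006, §1, p. 11] -/
theorem mapTotalBr_aut_mul_apply {G : Obj} (γ δ : Aut G) (x : Σ e : 𝓥.Edge G, 𝓥.Br e) :
    𝓥.mapTotalBr (γ * δ).hom x = 𝓥.mapTotalBr γ.hom (𝓥.mapTotalBr δ.hom x) :=
  h𝓥.mapBr_comp δ.hom γ.hom x

/-- The unit of `Aut G` fixes every branch. [cite: MochizukiSemiAnbd2006, §1, p. 11] -/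
theorem mapTotalBr_aut_one_apply {G : Obj} (x : Σ e : 𝓥.Edge G, 𝓥.Br e) :
    𝓥.mapTotalBr (1 : Aut G).hom x = x :=
  h𝓥.mapBr_id G x

/-- If an arrow fixes a branch, so does any arrow equal to it composed with an arrow fixing it:
branches fixed by `f` and by `g` are fixed by `f ≫ g`. [cite: MochizukiSemiAnbd2006, §1, p. 11] -/
theorem mapTotalBr_comp_eq_self {G : Obj} {f g : G ⟶ G} {x : Σ e : 𝓥.Edge G, 𝓥.Br e}
    (hf : 𝓥.mapTotalBr f x = x) (hg : 𝓥.mapTotalBr g x = x) : 𝓥.mapTotalBr (f ≫ g) x = x := by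
  rw [h𝓥.mapBr_comp, hf, hg]

/-! #### The branch maps at a vertex (`mapBrAt`, §1 p.14) -/

/-- The identity induces the identity on the branches abutting to a vertex (on underlying data; the
types differ by the cast `mapV (𝟙 G) v = v`). [cite: MochizukiSemiAnbd2006, §1, p. 14] -/
theorem mapBrAt_id_val {G : Obj} (v : 𝓥.Vert G) (x : 𝓥.BrAt G v) :
    (𝓥.mapBrAt (𝟙 G) v x).1 = x.1 :=
  h𝓥.mapBr_id G x.1

/-- A composite induces the composite on the branches abutting to a vertex (on underlying data).
[cite: MochizukiSemiAnbd2006, §1, p. 14] -/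
theorem mapBrAt_comp_val {G H K : Obj} (f : G ⟶ H) (g : H ⟶ K) (v : 𝓥.Vert G) (x : 𝓥.BrAt G v) :
    (𝓥.mapBrAt (f ≫ g) v x).1 = (𝓥.mapBrAt g (𝓥.mapV f v) (𝓥.mapBrAt f v x)).1 :=
  h𝓥.mapBr_comp f g x.1

/-- **The identity is an immersion of semi-graphs** (§1 p.14). [cite: MochizukiSemiAnbd2006, §1, p. 14] -/
theorem isGraphImmersion_id (G : Obj) : 𝓥.IsGraphImmersion (𝟙 G) := by
  intro v x y hxy
  apply Subtype.ext
  rw [← h𝓥.mapBrAt_id_val v x, ← h𝓥.mapBrAt_id_val v y, hxy]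

/-- **The identity is an excision of semi-graphs** (§1 p.14). [cite: MochizukiSemiAnbd2006, §1, p. 14] -/
theorem isGraphExcision_id (G : Obj) : 𝓥.IsGraphExcision (𝟙 G) := by
  intro v
  refine ⟨h𝓥.isGraphImmersion_id G v, fun y => ?_⟩
  have hv : 𝓥.mapV (𝟙 G) v = v := 𝓥.mapV_id G v
  refine ⟨⟨y.1, y.2.trans (congrArg some hv)⟩, Subtype.ext ?_⟩
  exact h𝓥.mapBr_id G y.1

/-- **The identity is an embedding of semi-graphs** (§1 p.12). [cite: MochizukiSemiAnbd2006, §1, p. 12] -/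
theorem isGraphEmbedding_id (G : Obj) : 𝓥.IsGraphEmbedding (𝟙 G) := by
  refine ⟨fun a b hab => ?_, fun a b hab => ?_, fun e b v hb => ?_⟩
  · rwa [𝓥.mapV_id, 𝓥.mapV_id] at hab
  · rwa [𝓥.mapE_id, 𝓥.mapE_id] at hab
  · have h := abut_eq_of_sigma_eq (h𝓥.mapBr_id G ⟨e, b⟩)
    change 𝓥.abut (𝓥.mapBr (𝟙 G) b) = 𝓥.abut b at h
    rw [← h, hb, 𝓥.mapV_id]

/-- **Immersions of semi-graphs are closed under composition** (§1 p.14: injective on the branches at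
each vertex). [cite: MochizukiSemiAnbd2006, §1, p. 14] -/
theorem isGraphImmersion_comp {G H K : Obj} {f : G ⟶ H} {g : H ⟶ K}
    (hf : 𝓥.IsGraphImmersion f) (hg : 𝓥.IsGraphImmersion g) : 𝓥.IsGraphImmersion (f ≫ g) := by
  intro v x y hxy
  have h' : (𝓥.mapBrAt g (𝓥.mapV f v) (𝓥.mapBrAt f v x)).1 =
      (𝓥.mapBrAt g (𝓥.mapV f v) (𝓥.mapBrAt f v y)).1 := by
    rw [← h𝓥.mapBrAt_comp_val, ← h𝓥.mapBrAt_comp_val, hxy]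
  exact hf v (hg (𝓥.mapV f v) (Subtype.ext h'))

/-- **Excisions of semi-graphs are closed under composition** (§1 p.14: bijective on the branches at
each vertex). [cite: MochizukiSemiAnbd2006, §1, p. 14] -/
theorem isGraphExcision_comp {G H K : Obj} {f : G ⟶ H} {g : H ⟶ K}
    (hf : 𝓥.IsGraphExcision f) (hg : 𝓥.IsGraphExcision g) : 𝓥.IsGraphExcision (f ≫ g) := by
  intro v
  refine ⟨h𝓥.isGraphImmersion_comp (fun w => (hf w).1) (fun w => (hg w).1) v, fun z => ?_⟩
  have hv : 𝓥.mapV (f ≫ g) v = 𝓥.mapV g (𝓥.mapV f v) := 𝓥.mapV_comp f g v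
  obtain ⟨y, hy⟩ := (hg (𝓥.mapV f v)).2 ⟨z.1, z.2.trans (congrArg some hv)⟩
  obtain ⟨x, hx⟩ := (hf v).2 y
  refine ⟨x, Subtype.ext ?_⟩
  rw [h𝓥.mapBrAt_comp_val, hx, hy]

/-- **Embeddings of semi-graphs are closed under composition** (§1 p.12: isomorphisms onto
sub-semi-graphs compose). [cite: MochizukiSemiAnbd2006, §1, p. 12] -/
theorem isGraphEmbedding_comp {G H K : Obj} {f : G ⟶ H} {g : H ⟶ K}
    (hf : 𝓥.IsGraphEmbedding f) (hg : 𝓥.IsGraphEmbedding g) : 𝓥.IsGraphEmbedding (f ≫ g) := by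
  obtain ⟨hfV, hfE, hfB⟩ := hf
  obtain ⟨hgV, hgE, hgB⟩ := hg
  refine ⟨fun a b hab => ?_, fun a b hab => ?_, fun e b v hb => ?_⟩
  · rw [𝓥.mapV_comp, 𝓥.mapV_comp] at hab
    exact hfV (hgV hab)
  · rw [𝓥.mapE_comp, 𝓥.mapE_comp] at hab
    exact hfE (hgE hab)
  · have h := abut_eq_of_sigma_eq (h𝓥.mapBr_comp f g ⟨e, b⟩)
    change 𝓥.abut (𝓥.mapBr (f ≫ g) b) = 𝓥.abut (𝓥.mapBr g (𝓥.mapBr f b)) at h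
    rw [h, 𝓥.mapV_comp] at hb
    exact hfB e b v (hgB _ _ _ hb)

/-! #### Def 4.1 (i) and Def 5.1 (i)(c) consumers -/

/-- **The fixing clause of Def 4.1 (i) is met by `γ = 1` at every vertex**: the identity
automorphism fixes `v` "as well as all of the branches of closed edges … that abut to `v`" — so the
piecewise-faithfulness condition `Loc.IsPiecewiseFaithful` is never vacuous at a semi-graph with a
vertex. [cite: MochizukiSemiAnbd2006, Def 4.1 (i), p. 50] -/
theorem one_fixes_vertex_and_branches {G : Obj} (v : 𝓥.Vert G) :
    𝓥.mapV (1 : Aut G).hom v = v ∧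
      ∀ x : (Σ e : 𝓥.Edge G, 𝓥.Br e), 𝓥.IsClosedEdge x.1 → 𝓥.abut x.2 = some v →
        𝓥.mapTotalBr (1 : Aut G).hom x = x :=
  ⟨𝓥.mapV_id G v, fun x _ _ => h𝓥.mapBr_id G x⟩

end BrLaws

/-- **Def 4.1 (i) at the trivial group** (no law needed): `Γ = 1` acts piecewise faithfully on every
`𝔾` (the only element is the identity). [cite: MochizukiSemiAnbd2006, Def 4.1 (i), p. 50] -/
theorem isPiecewiseFaithful_bot (G : Obj) : Loc.IsPiecewiseFaithful 𝓥 G ⊥ :=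
  fun _ hγ _ => Subgroup.mem_bot.mp hγ

end AnyContainer

end SemiAnbdVocab

/-! ### Def 5.1 (i)(c): f-184's instance forms with the binder `hid` discharged from the laws -/

section Def51

variable {Obj : Type u} [Category.{v} Obj] {𝓥 : SemiAnbdVocab.{u, v, w} Obj} (h𝓥 : 𝓥.BrLaws)
variable (G : Obj) (PA : ProfiniteGrp.{w}) (ρ : PA →* Aut G)
include h𝓥

/-- **Def 5.1 (i)(c) holds at every open `H ≤ Ker ρ_𝔾`**, for every container whose branch maps are
functorial (`BrLaws`; `def51CondC_of_le_ker` of `ArithmeticDef51CondCClosures.lean` with its binder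
`hid` supplied by the law `mapBr_id`). [cite: MochizukiSemiAnbd2006, Def 5.1 (i)(c), p. 62] -/
theorem def51CondC_of_brLaws_of_le_ker (H : OpenSubgroup PA) (hH : (H : Subgroup PA) ≤ ρ.ker) :
    Def51CondC 𝓥 G PA ρ H :=
  def51CondC_of_le_ker 𝓥 G PA ρ H (h𝓥.mapBr_id G) hH

/-- **The trivial action satisfies Def 5.1 (i)(c) at every open subgroup**, for every container whose
branch maps are functorial. [cite: MochizukiSemiAnbd2006, Def 5.1 (i)(c), p. 62] -/
theorem def51CondC_one_of_brLaws (H : OpenSubgroup PA) : Def51CondC 𝓥 G PA 1 H :=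
  def51CondC_one 𝓥 G PA (h𝓥.mapBr_id G) H

/-- Under the laws, the fixing clauses of Def 5.1 (i)(c) pass to inverses: if `h ∈ H` fixes every
branch then so does `h⁻¹` (used silently when (c) is read as "the action of the GROUP `H` is
trivial"). [cite: MochizukiSemiAnbd2006, Def 5.1 (i)(c), p. 62] -/
theorem Def51CondC.fixesBr_inv {H : OpenSubgroup PA} (hC : Def51CondC 𝓥 G PA ρ H) (h : PA)
    (hh : h ∈ H) (x : Σ e : 𝓥.Edge G, 𝓥.Br e) : 𝓥.mapTotalBr (ρ h⁻¹).hom x = x := by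
  conv_lhs => rw [← hC.fixesBr h hh x]
  rw [map_inv]
  exact h𝓥.mapTotalBr_aut_inv_apply (ρ h) x

end Def51

/-! ### Discharge at the real vocabulary -/

section Real

universe v₁ u₁ u₂

open SgAQuot

/-- At the real container a composite arrow acts on branches by the composite map (functoriality of
the underlying morphism of semi-graphs, by `rfl`). [cite: MochizukiSemiAnbd2006, §1, p. 11] -/
theorem SemiAnbdVocab.ofReal_mapTotalBr_comp (R : SgA.BridgeResidual.{v₁, u₁, u₂})
    {G H K : SgA.{v₁, u₁, u₂}} (f : G ⟶ H) (g : H ⟶ K)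
    (x : Σ e : (SemiAnbdVocab.ofReal R).Edge G, (SemiAnbdVocab.ofReal R).Br e) :
    (SemiAnbdVocab.ofReal R).mapTotalBr (f ≫ g) x =
      (SemiAnbdVocab.ofReal R).mapTotalBr g ((SemiAnbdVocab.ofReal R).mapTotalBr f x) := by
  obtain ⟨e, b⟩ := x
  rfl

/-- **G-f184-1 DISCHARGED at the real vocabulary**: for every residual `R`, the branch maps of the
container `SemiAnbdVocab.ofReal R` are functorial (both laws by `rfl`: the underlying morphism of
semi-graphs of a composite / identity of `SgA` is the composite / identity, t1's `SemiGraph`).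
[cite: MochizukiSemiAnbd2006, §1, p. 11] -/
theorem SemiAnbdVocab.ofReal_brLaws (R : SgA.BridgeResidual.{v₁, u₁, u₂}) :
    (SemiAnbdVocab.ofReal R).BrLaws :=
  ⟨SemiAnbdVocab.ofReal_mapTotalBr_id R, fun f g x => SemiAnbdVocab.ofReal_mapTotalBr_comp R f g x⟩

/-- … and so are those of the one-universe container `SemiAnbdVocab.ofRealOfTempered T` (whose only
residual is the class of tempered arrows). [cite: MochizukiSemiAnbd2006, §1, p. 11] -/
theorem SemiAnbdVocab.ofRealOfTempered_brLaws (T : SgA.TemperedResidual.{u₂}) :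
    (SemiAnbdVocab.ofRealOfTempered T).BrLaws :=
  SemiAnbdVocab.ofReal_brLaws _

/-- **Immersions / excisions / embeddings of the underlying semi-graphs compose in the ambient
category of [SemiAnbd] §§4–5** (instances of the container-level closure lemmas at `ofReal`).
[cite: MochizukiSemiAnbd2006, §1, p. 14] -/
theorem SemiAnbdVocab.ofReal_isGraphEmbedding_comp (R : SgA.BridgeResidual.{v₁, u₁, u₂})
    {G H K : SgA.{v₁, u₁, u₂}} {f : G ⟶ H} {g : H ⟶ K}
    (hf : (SemiAnbdVocab.ofReal R).IsGraphEmbedding f)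
    (hg : (SemiAnbdVocab.ofReal R).IsGraphEmbedding g) :
    (SemiAnbdVocab.ofReal R).IsGraphEmbedding (f ≫ g) :=
  (SemiAnbdVocab.ofReal_brLaws R).isGraphEmbedding_comp hf hg

end Real

end Literature.AnabelianGeometry.SemiGraphs
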